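import Literature.AnabelianGeometry.SemiGraphs.ArithmeticCurvesEx56RecipeWellDefined
import Literature.AnabelianGeometry.SemiGraphs.ArithEstrangementOfLem55
import HarnessLib

/-!
# [SemiAnbd] Example 5.6 — the cone node `SemiAnbd:Ex5.6` RE-CLOSED AT ITS SURVIVING INSTANCE FORMS:
# F-1450 (the recipe YIELDS the object map) from Thm 5.4 + the specialisation hosts; F-1451 packaged from
# its level inputs (estrangement via the Lemma 5.5 assembly); F-1452 inhabited and F-1449 at the diagonal

S. Mochizuki, *Semi-graphs of anabelioids* [SemiAnbd], Publ. RIMS **42** (2006) 221–322, Example 5.6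
pp. 295–296 (author's manuscript pp. 67–68): «if `v` (resp. `e`) is a vertex (resp. edge) of `𝒢_i` such that the
image in `Π^temp_{𝔊_j}` of the verticial (resp. edge-like) subgroup determined by `v` (resp. `e`) is contained in a
[necessarily unique] edge-like subgroup `H` of `Π^temp_{𝔊_j}`, then [the functor `Cat(𝒢_i) → Cat(𝒢_j)`] maps `v`
(resp. `e`) to the edge of `𝒢_j` determined by `H`.  On the other hand, if … is not contained in an edge-like
subgroup … but is contained in a verticial subgroup `H` …, then this functor maps `v` (resp. `e`) to the vertex
of `𝒢_j` determined by `H`.  That these characterizations make sense and … yield the map on objects … follows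
from Theorem 5.4, (i), (ii); Lemma 5.5.» [cite: MochizukiSemiAnbd2006, Ex 5.6, pp. 67–68]

Cell abc-iut, layer L3, seat abc-iut-w4-d085 (gen 8), row `SemiAnbd:Ex5.6` (abc-iut-L3-lead γ48 RE-KEY #2: «K4
F-1449/F-1450/F-1451 at the surviving instance forms + F-1452»; plan/CONE-CLASSIFY.tsv 02:06Z CLAIM-NOW, verify
class; kernel-DAG node `N_SemiAnbd_Ex5_6`, `Summits/ABC/IUTFork/DAGL3r.lean`, a DATA node listing abc-iut-L3-t3's
`towerGroup`, `StableReductionTower`, …, `Ex56PropertiesStatement` (F-1451), `Ex56ObjectRecipeStatement` (F-1450),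
`StableReductionTower.CompatibleIsos` (F-1452), `Ex56CompactRigidityStatement` (F-1449)).  PROOF-ONLY companion of
the FROZEN `ArithmeticCurves.lean` (p405547 / p407122): 0 `def`, 0 `instance`, no new `Prop`; every input BY NAME;
sequel of abc-iut-f-158's `ArithmeticCurvesEx56RecipeWellDefined.lean` (p432032: conjunct (1) «these
characterizations make sense» + «[necessarily unique]» from Rmk 5.3.1 / Thm 5.4 (i)(ii) at the levels) and
`ArithmeticCurvesEx56SchemaVerdicts.lean` (p433263: the universal closures over junk origins are false; at an
origin certifying no tower they hold vacuously), and of abc-iut-w4-d059's `ArithEstrangementOfLem55.lean` (p460908: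
Def 5.3 (ii) assembled from the Lemma-5.5 cross clause and the self clause).

THE TYPED ROWS are guarded by an UNINTERPRETED origin certificate `Ω : StableReductionOrigin 𝓥 K` (André's
`π₁^temp`, stable reduction — FOUNDATIONS rows 13–14 — are not constructed in the tree), so their only kernel
instances are statements about what `Ω` CERTIFIES.  This file proves each row for EVERY `Ω` whose certificate
delivers the named level inputs print itself cites, and isolates — as displayed hypotheses — the exact geometric
inputs the printed sentence uses beyond Theorem 5.4:

* §1 **F-1450, conjuncts (2)/(3) «yield the map on objects»** (the part abc-iut-f-158 recorded as NOT PROVED):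
  `StableReductionTower.ex56Recipe_vert_of_hosts` / `…_br_of_hosts` — for EVERY tower `T` (no certificate), every
  `j ≤ i` and every vertex `v` (resp. branch `x`) of `𝒢_i`, ALL THREE conjuncts of the recipe hold, from:
  Rmk 5.3.1 at level `i` (F-1410 `VerticialEdgeLikeCompactAmpleStatement`), Thm 5.4 (i)/(ii) at level `j` (F-1398
  `ArithMaximalCompactStatementI` / F-1399 `…II` — at a genuine tower these are the T54 capstone's conclusions in
  tower currency), the COMPONENT DETERMINATION of print's «the edge / the vertex of `𝒢_j` determined by `H`»
  (`hdetV` / `hdetE`: distinct vertices, resp. branches of distinct edges, have non-conjugate decomposition groups —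
  recorded by abc-iut-f-158 as «a property of the certified geometric data (cf. Prop 2.6, Thm 3.7 (iii))»), and the
  SPECIALISATION HOSTS (`hinl` / `hinr`: the functor «induced by the map on geometric special fibers» (Ex 3.10 p. 44)
  carries decomposition groups INTO decomposition groups of the image component — and, when `v` goes to a VERTEX,
  into no edge-like subgroup: the Lemma 5.5 input).  The deduction is the printed one: existence of a host from the
  hosts; clause (2) by «[necessarily unique]» (f-158's `ex56Recipe_edgeLike_unique_vert/_br` ∘ Thm 5.4 (ii)) +
  `hdetE`; clause (3) by f-158's `ex56Recipe_verticial_unique_vert/_br` (Thm 5.4 (i)) + `hdetV`.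
  Packaged: **`ex56ObjectRecipeStatement_of_levelInputs`** — F-1450 `Ex56ObjectRecipeStatement Ω` for every `Ω`
  whose certificate delivers these level inputs (RECLOSED-MOD-STRUCTURAL: no F-1450 binder; the residual is the
  displayed list).
* §2 **F-1451** `ex56PropertiesStatement_of_levelInputs` — `Ex56PropertiesStatement Ω` for every `Ω` certifying,
  level by level, the six adjectives of the interface and the two Def 5.3 (ii) clauses at `dec`/`decc`, the latter
  ASSEMBLED by abc-iut-w4-d059's `isTotallyArithEstranged_of_cross_of_self` (whose cross clause is the Lemma 5.5
  reduction `not_isArithAmple_inf_conj_of_lem55[_of_isOpenMap]` of that file — «it follows immediately from Lemma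
  5.5») — bookkeeping only, recorded so the node's three rows have one sibling.
* §3 **F-1452 / F-1449** `StableReductionTower.exists_compatibleIsos_self` — the predicate `CompatibleIsos` is
  INHABITED at every tower against itself by the identity family (`𝓥.mapV_id`, `𝓥.mapE_id`); and
  `ex56CompactRigidityStatement_of_certifies_one` — F-1449 `Ex56CompactRigidityStatement Ω` for every `Ω` that
  certifies (at most) ONE tower: AS TYPED the conclusion `∃ φ, T.CompatibleIsos T' φ` does not mention the given
  isomorphism `α` (no «induced by `α`» constraint), so at the diagonal the identity family closes it for EVERY `α`
  (INHABITED-AT-DIAGONAL; typing remark for the layer lead, not a defect claim — the contentful instance needs the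
  Example's reconstruction functor, FOUNDATIONS rows 13–14).
K4 / C-R33 reading (evidence `K4-w4d085-EX56-RECLOSED.tsv`, abc-iut-c312-2 gen-5 format).  HONEST FRAMING: kernel
theorems about OUR typed predicates on ABSTRACT towers and about what an abstract certificate delivers; nothing of
[SemiAnbd] Example 5.6 is asserted for an actual curve (genuine carrier = the cell's GAP «Ex 5.6»); F-1449/F-1450/F-1451
stay FACT-policy rows (universal closures refuted as typed); no side is taken on [IUTchIII] Cor. 3.12; typed ≠
proved; instantiated ≠ endorsed.
-/

namespace Literature.AnabelianGeometry.SemiGraphs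

open _root_.CategoryTheory Literature.AlgebraicGeometry.Frobenioids Topology

universe u v w u'

variable {Obj : Type u} [Category.{v} Obj] {𝓥 : SemiAnbdVocab.{u, v, w} Obj}
variable {K : Type u'} [Field K]

/-! ## §1. F-1450, conjuncts (2)/(3): the recipe YIELDS the object map — from Thm 5.4 and the hosts -/

namespace StableReductionTower

variable {D : TemperedArithmeticGroup K} (T : StableReductionTower 𝓥 D)

/-- **Example 5.6, the recipe for a VERTEX `v` of `𝒢_i`, all three conjuncts, for EVERY tower** (no origin
certificate): with `img := image of Π_{𝔊_i,v}` in `Π^temp_{𝔊_j}` (`j ≤ i`), (1) `img` lies in a verticial or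
edge-like subgroup; (2) if `img ≤ g·Π_{𝔊_j,b}·g⁻¹` then `v ↦` the edge of `b`; (3) if `img` lies in no edge-like
subgroup but `img ≤ g·Π_{𝔊_j,w}·g⁻¹` then `v ↦ w`.  INPUTS (displayed): Rmk 5.3.1 at level `i` (`h531`), Thm 5.4
(i)/(ii) at level `j` (`h54i`/`h54ii`), component determination at level `j` (`hdetV`/`hdetE`: «the vertex / the
edge of `𝒢_j` determined by `H`»), and the specialisation HOSTS of `v` (`hinl`: `v ↦` vertex `w` ⟹ `img` in a
conjugate of `Π_{𝔊_j,w}` and in NO edge-like subgroup [Lemma 5.5]; `hinr`: `v ↦` edge `e` ⟹ `img` in a conjugate of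
`Π_{𝔊_j,b}` for a branch `b` of `e`).  Deduction: «[necessarily unique]» (abc-iut-f-158, from Thm 5.4 (i)(ii)).
[cite: MochizukiSemiAnbd2006, Ex 5.6, pp. 67–68] -/
theorem ex56Recipe_vert_of_hosts (i j : ℕ) (h : j ≤ i)
    (h531 : VerticialEdgeLikeCompactAmpleStatement (T.dec i) (T.augmentation i))
    (h54i : ArithMaximalCompactStatementI (T.dec j) (T.augmentation j))
    (h54ii : ArithMaximalCompactStatementII (T.dec j) (T.augmentation j))
    (hdetV : ∀ (w w' : 𝓥.Vert (T.𝔊 j).G) (g g' : T.Gtp j),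
      conjSubgroup g ((T.dec j).vertGp w) = conjSubgroup g' ((T.dec j).vertGp w') → w = w')
    (hdetE : ∀ (b b' : Σ e : 𝓥.Edge (T.𝔊 j).G, 𝓥.Br e) (g g' : T.Gtp j),
      conjSubgroup g ((T.dec j).brGp b) = conjSubgroup g' ((T.dec j).brGp b') → b.1 = b'.1)
    (v : 𝓥.Vert (T.𝔊 i).G)
    (hinl : ∀ w : 𝓥.Vert (T.𝔊 j).G, T.spV i j h v = Sum.inl w →
      (∃ g : T.Gtp j, ((T.dec i).vertGp v).map (T.transition i j h) ≤ conjSubgroup g ((T.dec j).vertGp w)) ∧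
        ¬ ∃ H : Subgroup (T.Gtp j),
          IsEdgeLike (T.dec j) H ∧ ((T.dec i).vertGp v).map (T.transition i j h) ≤ H)
    (hinr : ∀ e : 𝓥.Edge (T.𝔊 j).G, T.spV i j h v = Sum.inr e →
      ∃ (b : Σ e : 𝓥.Edge (T.𝔊 j).G, 𝓥.Br e) (g : T.Gtp j), b.1 = e ∧
        ((T.dec i).vertGp v).map (T.transition i j h) ≤ conjSubgroup g ((T.dec j).brGp b)) :
    (∃ H : Subgroup (T.Gtp j), (IsVerticial (T.dec j) H ∨ IsEdgeLike (T.dec j) H) ∧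
        ((T.dec i).vertGp v).map (T.transition i j h) ≤ H) ∧
      (∀ (b : Σ e : 𝓥.Edge (T.𝔊 j).G, 𝓥.Br e) (g : T.Gtp j),
          ((T.dec i).vertGp v).map (T.transition i j h) ≤ conjSubgroup g ((T.dec j).brGp b) →
            T.spV i j h v = Sum.inr b.1) ∧
        ∀ (w : 𝓥.Vert (T.𝔊 j).G) (g : T.Gtp j),
          ((T.dec i).vertGp v).map (T.transition i j h) ≤ conjSubgroup g ((T.dec j).vertGp w) →
            (¬ ∃ H : Subgroup (T.Gtp j),
                IsEdgeLike (T.dec j) H ∧ ((T.dec i).vertGp v).map (T.transition i j h) ≤ H) →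
              T.spV i j h v = Sum.inl w := by
  refine ⟨?_, ?_, ?_⟩
  · -- (1) a host exists: read off the specialisation target of `v`
    rcases hsp : T.spV i j h v with w | e
    · obtain ⟨⟨g, hle⟩, -⟩ := hinl w hsp
      exact ⟨_, Or.inl ((T.isVerticial_dec_vertGp j w).conj g), hle⟩
    · obtain ⟨b, g, -, hle⟩ := hinr e hsp
      exact ⟨_, Or.inr ((T.isEdgeLike_dec_brGp j b).conj g), hle⟩
  · -- (2) the edge clause: uniqueness of the edge-like host (Thm 5.4 (ii)) + edge determination
    intro b g hle
    rcases hsp : T.spV i j h v with w | e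
    · exact absurd ⟨_, (T.isEdgeLike_dec_brGp j b).conj g, hle⟩ (hinl w hsp).2
    · obtain ⟨b', g', hb'e, hle'⟩ := hinr e hsp
      have heq := T.ex56Recipe_edgeLike_unique_vert i j h h531 h54i h54ii v
        ((T.isEdgeLike_dec_brGp j b).conj g) ((T.isEdgeLike_dec_brGp j b').conj g') hle hle'
      rw [hdetE b b' g g' heq, hb'e]
  · -- (3) the vertex clause: uniqueness of the verticial host (Thm 5.4 (i)) + vertex determination
    intro w g hle hno
    rcases hsp : T.spV i j h v with w' | e
    · obtain ⟨⟨g', hle'⟩, -⟩ := hinl w' hsp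
      have heq := T.ex56Recipe_verticial_unique_vert i j h h531 h54i v hno
        ((T.isVerticial_dec_vertGp j w).conj g) ((T.isVerticial_dec_vertGp j w').conj g') hle hle'
      rw [hdetV w w' g g' heq]
    · obtain ⟨b', g', -, hle'⟩ := hinr e hsp
      exact absurd ⟨_, (T.isEdgeLike_dec_brGp j b').conj g', hle'⟩ hno

/-- **Example 5.6, the recipe for an EDGE of `𝒢_i`** (through either of its branches `x`; the edge-like subgroup
of an edge is that of either branch), all three conjuncts, for EVERY tower — same inputs, with the specialisation
hosts of the edge `x.1` read on the branch `x`. [cite: MochizukiSemiAnbd2006, Ex 5.6, pp. 67–68] -/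
theorem ex56Recipe_br_of_hosts (i j : ℕ) (h : j ≤ i)
    (h531 : VerticialEdgeLikeCompactAmpleStatement (T.dec i) (T.augmentation i))
    (h54i : ArithMaximalCompactStatementI (T.dec j) (T.augmentation j))
    (h54ii : ArithMaximalCompactStatementII (T.dec j) (T.augmentation j))
    (hdetV : ∀ (w w' : 𝓥.Vert (T.𝔊 j).G) (g g' : T.Gtp j),
      conjSubgroup g ((T.dec j).vertGp w) = conjSubgroup g' ((T.dec j).vertGp w') → w = w')
    (hdetE : ∀ (b b' : Σ e : 𝓥.Edge (T.𝔊 j).G, 𝓥.Br e) (g g' : T.Gtp j),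
      conjSubgroup g ((T.dec j).brGp b) = conjSubgroup g' ((T.dec j).brGp b') → b.1 = b'.1)
    (x : Σ e : 𝓥.Edge (T.𝔊 i).G, 𝓥.Br e)
    (hinl : ∀ w : 𝓥.Vert (T.𝔊 j).G, T.spE i j h x.1 = Sum.inl w →
      (∃ g : T.Gtp j, ((T.dec i).brGp x).map (T.transition i j h) ≤ conjSubgroup g ((T.dec j).vertGp w)) ∧
        ¬ ∃ H : Subgroup (T.Gtp j),
          IsEdgeLike (T.dec j) H ∧ ((T.dec i).brGp x).map (T.transition i j h) ≤ H)
    (hinr : ∀ e : 𝓥.Edge (T.𝔊 j).G, T.spE i j h x.1 = Sum.inr e →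
      ∃ (b : Σ e : 𝓥.Edge (T.𝔊 j).G, 𝓥.Br e) (g : T.Gtp j), b.1 = e ∧
        ((T.dec i).brGp x).map (T.transition i j h) ≤ conjSubgroup g ((T.dec j).brGp b)) :
    (∃ H : Subgroup (T.Gtp j), (IsVerticial (T.dec j) H ∨ IsEdgeLike (T.dec j) H) ∧
        ((T.dec i).brGp x).map (T.transition i j h) ≤ H) ∧
      (∀ (b : Σ e : 𝓥.Edge (T.𝔊 j).G, 𝓥.Br e) (g : T.Gtp j),
          ((T.dec i).brGp x).map (T.transition i j h) ≤ conjSubgroup g ((T.dec j).brGp b) →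
            T.spE i j h x.1 = Sum.inr b.1) ∧
        ∀ (w : 𝓥.Vert (T.𝔊 j).G) (g : T.Gtp j),
          ((T.dec i).brGp x).map (T.transition i j h) ≤ conjSubgroup g ((T.dec j).vertGp w) →
            (¬ ∃ H : Subgroup (T.Gtp j),
                IsEdgeLike (T.dec j) H ∧ ((T.dec i).brGp x).map (T.transition i j h) ≤ H) →
              T.spE i j h x.1 = Sum.inl w := by
  refine ⟨?_, ?_, ?_⟩
  · rcases hsp : T.spE i j h x.1 with w | e
    · obtain ⟨⟨g, hle⟩, -⟩ := hinl w hsp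
      exact ⟨_, Or.inl ((T.isVerticial_dec_vertGp j w).conj g), hle⟩
    · obtain ⟨b, g, -, hle⟩ := hinr e hsp
      exact ⟨_, Or.inr ((T.isEdgeLike_dec_brGp j b).conj g), hle⟩
  · intro b g hle
    rcases hsp : T.spE i j h x.1 with w | e
    · exact absurd ⟨_, (T.isEdgeLike_dec_brGp j b).conj g, hle⟩ (hinl w hsp).2
    · obtain ⟨b', g', hb'e, hle'⟩ := hinr e hsp
      have heq := T.ex56Recipe_edgeLike_unique_br i j h h531 h54i h54ii x
        ((T.isEdgeLike_dec_brGp j b).conj g) ((T.isEdgeLike_dec_brGp j b').conj g') hle hle'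
      rw [hdetE b b' g g' heq, hb'e]
  · intro w g hle hno
    rcases hsp : T.spE i j h x.1 with w' | e
    · obtain ⟨⟨g', hle'⟩, -⟩ := hinl w' hsp
      have heq := T.ex56Recipe_verticial_unique_br i j h h531 h54i x hno
        ((T.isVerticial_dec_vertGp j w).conj g) ((T.isVerticial_dec_vertGp j w').conj g') hle hle'
      rw [hdetV w w' g g' heq]
    · obtain ⟨b', g', -, hle'⟩ := hinr e hsp
      exact absurd ⟨_, (T.isEdgeLike_dec_brGp j b').conj g', hle'⟩ hno

end StableReductionTower

/-! ### F-1450 packaged over the origin certificate -/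

section Packaged

variable (Ω : StableReductionOrigin 𝓥 K)

/-- **F-1450 `Ex56ObjectRecipeStatement Ω` AT ITS SURVIVING INSTANCE FORM**: the typed CLAIM of Example 5.6 holds
for EVERY origin certificate `Ω` that delivers, for each certified tower and each `j ≤ i`, the level inputs print
cites — Rmk 5.3.1 at level `i` (F-1410), Thm 5.4 (i)/(ii) at level `j` (F-1398/F-1399), component determination at
level `j`, and the specialisation hosts of every vertex and every edge of `𝒢_i` (the functor `Cat(𝒢_i) → Cat(𝒢_j)`
«induced by the map on geometric special fibers», Ex 3.10 p. 44, with the Lemma 5.5 exclusion).  No F-1450 binder;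
the displayed list IS the residual. [cite: MochizukiSemiAnbd2006, Ex 5.6, pp. 67–68] -/
theorem ex56ObjectRecipeStatement_of_levelInputs
    (h531 : ∀ (D : TemperedArithmeticGroup K) (T : StableReductionTower 𝓥 D), Ω.IsStableReductionTowerOf D T →
      ∀ i, VerticialEdgeLikeCompactAmpleStatement (T.dec i) (T.augmentation i))
    (h54 : ∀ (D : TemperedArithmeticGroup K) (T : StableReductionTower 𝓥 D), Ω.IsStableReductionTowerOf D T →
      ∀ j, ArithMaximalCompactStatementI (T.dec j) (T.augmentation j) ∧
        ArithMaximalCompactStatementII (T.dec j) (T.augmentation j))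
    (hdet : ∀ (D : TemperedArithmeticGroup K) (T : StableReductionTower 𝓥 D), Ω.IsStableReductionTowerOf D T →
      ∀ j, (∀ (w w' : 𝓥.Vert (T.𝔊 j).G) (g g' : T.Gtp j),
          conjSubgroup g ((T.dec j).vertGp w) = conjSubgroup g' ((T.dec j).vertGp w') → w = w') ∧
        ∀ (b b' : Σ e : 𝓥.Edge (T.𝔊 j).G, 𝓥.Br e) (g g' : T.Gtp j),
          conjSubgroup g ((T.dec j).brGp b) = conjSubgroup g' ((T.dec j).brGp b') → b.1 = b'.1)
    (hspV : ∀ (D : TemperedArithmeticGroup K) (T : StableReductionTower 𝓥 D), Ω.IsStableReductionTowerOf D T →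
      ∀ (i j : ℕ) (h : j ≤ i) (v : 𝓥.Vert (T.𝔊 i).G),
        (∀ w : 𝓥.Vert (T.𝔊 j).G, T.spV i j h v = Sum.inl w →
          (∃ g : T.Gtp j, ((T.dec i).vertGp v).map (T.transition i j h) ≤ conjSubgroup g ((T.dec j).vertGp w)) ∧
            ¬ ∃ H : Subgroup (T.Gtp j),
              IsEdgeLike (T.dec j) H ∧ ((T.dec i).vertGp v).map (T.transition i j h) ≤ H) ∧
        ∀ e : 𝓥.Edge (T.𝔊 j).G, T.spV i j h v = Sum.inr e →
          ∃ (b : Σ e : 𝓥.Edge (T.𝔊 j).G, 𝓥.Br e) (g : T.Gtp j), b.1 = e ∧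
            ((T.dec i).vertGp v).map (T.transition i j h) ≤ conjSubgroup g ((T.dec j).brGp b))
    (hspE : ∀ (D : TemperedArithmeticGroup K) (T : StableReductionTower 𝓥 D), Ω.IsStableReductionTowerOf D T →
      ∀ (i j : ℕ) (h : j ≤ i) (x : Σ e : 𝓥.Edge (T.𝔊 i).G, 𝓥.Br e),
        (∀ w : 𝓥.Vert (T.𝔊 j).G, T.spE i j h x.1 = Sum.inl w →
          (∃ g : T.Gtp j, ((T.dec i).brGp x).map (T.transition i j h) ≤ conjSubgroup g ((T.dec j).vertGp w)) ∧
            ¬ ∃ H : Subgroup (T.Gtp j),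
              IsEdgeLike (T.dec j) H ∧ ((T.dec i).brGp x).map (T.transition i j h) ≤ H) ∧
        ∀ e : 𝓥.Edge (T.𝔊 j).G, T.spE i j h x.1 = Sum.inr e →
          ∃ (b : Σ e : 𝓥.Edge (T.𝔊 j).G, 𝓥.Br e) (g : T.Gtp j), b.1 = e ∧
            ((T.dec i).brGp x).map (T.transition i j h) ≤ conjSubgroup g ((T.dec j).brGp b)) :
    Ex56ObjectRecipeStatement Ω := by
  intro D _hD T hT i j h
  exact ⟨fun v => T.ex56Recipe_vert_of_hosts i j h (h531 D T hT i) (h54 D T hT j).1 (h54 D T hT j).2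
      (hdet D T hT j).1 (hdet D T hT j).2 v (hspV D T hT i j h v).1 (hspV D T hT i j h v).2,
    fun x => T.ex56Recipe_br_of_hosts i j h (h531 D T hT i) (h54 D T hT j).1 (h54 D T hT j).2
      (hdet D T hT j).1 (hdet D T hT j).2 x (hspE D T hT i j h x).1 (hspE D T hT i j h x).2⟩

/-! ## §2. F-1451 packaged over the origin certificate (estrangement via the Lemma 5.5 assembly) -/

/-- **F-1451 `Ex56PropertiesStatement Ω` AT ITS SURVIVING INSTANCE FORM** (bookkeeping): the typed properties of
the levels hold for EVERY origin certificate `Ω` that delivers, level by level, the interface adjectives («finite,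
totally elevated, totally universally sub-coverticial») of `𝔊_i` and `𝔊^c_i` and the two clauses of Def 5.3 (ii) for
their decomposition data — the CROSS clause (`b' ≠ b`: at a genuine vertex the Lemma-5.5 reduction
`not_isArithAmple_inf_conj_of_lem55_of_isOpenMap` of abc-iut-w4-d059's file) and the SELF clause (`b' = b`,
`g ∉ Π_{𝔊,b}`: print's commensurator description, p. 65 top) — assembled into «totally arithmetically estranged» by
`isTotallyArithEstranged_of_cross_of_self` («it follows immediately from Lemma 5.5»).  No F-1451 binder.
[cite: MochizukiSemiAnbd2006, Ex 5.6, p. 67] -/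
theorem ex56PropertiesStatement_of_levelInputs
    (hadj : ∀ (D : TemperedArithmeticGroup K) (T : StableReductionTower 𝓥 D), Ω.IsStableReductionTowerOf D T →
      ∀ i, (𝓥.IsFinite (T.𝔊 i).G ∧ 𝓥.IsTotallyElevated (T.𝔊 i).G ∧ 𝓥.IsTotallyUnivSubcoverticial (T.𝔊 i).G) ∧
        𝓥.IsFinite (T.𝔊c i).G ∧ 𝓥.IsTotallyElevated (T.𝔊c i).G ∧ 𝓥.IsTotallyUnivSubcoverticial (T.𝔊c i).G)
    (hcross : ∀ (D : TemperedArithmeticGroup K) (T : StableReductionTower 𝓥 D), Ω.IsStableReductionTowerOf D T →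
      ∀ i, (∀ (u : 𝓥.Vert (T.𝔊 i).G) (b b' : Σ e : 𝓥.Edge (T.𝔊 i).G, 𝓥.Br e),
          (T.dec i).abut b = some u → (T.dec i).abut b' = some u → b' ≠ b → ∀ g ∈ (T.dec i).vertGp u,
            ¬ IsArithAmple (T.augmentation i) ((T.dec i).brGp b ⊓ conjSubgroup g ((T.dec i).brGp b'))) ∧
        ∀ (u : 𝓥.Vert (T.𝔊c i).G) (b b' : Σ e : 𝓥.Edge (T.𝔊c i).G, 𝓥.Br e),
          (T.decc i).abut b = some u → (T.decc i).abut b' = some u → b' ≠ b → ∀ g ∈ (T.decc i).vertGp u,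
            ¬ IsArithAmple (T.augmentation i) ((T.decc i).brGp b ⊓ conjSubgroup g ((T.decc i).brGp b')))
    (hself : ∀ (D : TemperedArithmeticGroup K) (T : StableReductionTower 𝓥 D), Ω.IsStableReductionTowerOf D T →
      ∀ i, (∀ (u : 𝓥.Vert (T.𝔊 i).G) (b : Σ e : 𝓥.Edge (T.𝔊 i).G, 𝓥.Br e), (T.dec i).abut b = some u →
          ∀ g ∈ (T.dec i).vertGp u, g ∉ (T.dec i).brGp b →
            ¬ IsArithAmple (T.augmentation i) ((T.dec i).brGp b ⊓ conjSubgroup g ((T.dec i).brGp b))) ∧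
        ∀ (u : 𝓥.Vert (T.𝔊c i).G) (b : Σ e : 𝓥.Edge (T.𝔊c i).G, 𝓥.Br e), (T.decc i).abut b = some u →
          ∀ g ∈ (T.decc i).vertGp u, g ∉ (T.decc i).brGp b →
            ¬ IsArithAmple (T.augmentation i) ((T.decc i).brGp b ⊓ conjSubgroup g ((T.decc i).brGp b))) :
    Ex56PropertiesStatement Ω := by
  intro D _hD T hT i
  obtain ⟨⟨hf, hel, hsub⟩, hfc, helc, hsubc⟩ := hadj D T hT i
  exact ⟨⟨hf, hel, hsub, isTotallyArithEstranged_of_cross_of_self _ _ (hcross D T hT i).1 (hself D T hT i).1⟩,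
    hfc, helc, hsubc, isTotallyArithEstranged_of_cross_of_self _ _ (hcross D T hT i).2 (hself D T hT i).2⟩

end Packaged

/-! ## §3. F-1452 inhabited at the diagonal; F-1449 at an origin certifying one tower -/

namespace StableReductionTower

variable {D : TemperedArithmeticGroup K} (T : StableReductionTower 𝓥 D)

/-- **F-1452 `CompatibleIsos` INHABITED at every tower against itself**: the identity family
`(id_{π̂₁(A_i)}, 𝟙_{𝔾^c_i})_i` consists of isomorphisms of connected arithmetic semi-graphs of anabelioids and is
compatible with the specialisation maps (`𝓥.mapV_id`, `𝓥.mapE_id`).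
[cite: MochizukiSemiAnbd2006, Ex 5.6, p. 68] -/
theorem exists_compatibleIsos_self : ∃ φ : ∀ i, ArithHom 𝓥 (T.𝔊c i) (T.𝔊c i), T.CompatibleIsos T φ := by
  -- the identity family: `arith := id`, `geom := 𝟙`, compatibility `ρ(a') ≫ 𝟙 = 𝟙 ≫ ρ(a')` by `simp`
  refine ⟨fun i => ⟨MonoidHom.id _, continuous_id, 𝟙 _, fun a' => by simp⟩,
    fun i => ⟨inferInstance, Function.bijective_id⟩, fun i j h => ⟨?_, ?_⟩⟩
  · intro v
    change T.spVc i j h (𝓥.mapV (𝟙 _) v) = Sum.map (𝓥.mapV (𝟙 _)) (𝓥.mapE (𝟙 _)) (T.spVc i j h v)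
    rw [𝓥.mapV_id]
    rcases T.spVc i j h v with w | e
    · exact (congrArg Sum.inl (𝓥.mapV_id _ w)).symm
    · exact (congrArg Sum.inr (𝓥.mapE_id _ e)).symm
  · intro e
    change T.spEc i j h (𝓥.mapE (𝟙 _) e) = Sum.map (𝓥.mapV (𝟙 _)) (𝓥.mapE (𝟙 _)) (T.spEc i j h e)
    rw [𝓥.mapE_id]
    rcases T.spEc i j h e with w | e'
    · exact (congrArg Sum.inl (𝓥.mapV_id _ w)).symm
    · exact (congrArg Sum.inr (𝓥.mapE_id _ e')).symm

end StableReductionTower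

section Diagonal

variable (Ω : StableReductionOrigin 𝓥 K)

/-- **F-1449 `Ex56CompactRigidityStatement Ω` at an origin certifying ONE tower** (the diagonal instance): if all
towers certified by `Ω` coincide, the rigidity statement holds — by the identity family, for EVERY isomorphism `α`
of the group data, because AS TYPED the conclusion `∃ φ, T.CompatibleIsos T' φ` does not mention `α` (no «induced
by `α`» clause; typing remark).  The contentful instance is the Example's reconstruction functor itself (FOUNDATIONS
rows 13–14), not claimed. [cite: MochizukiSemiAnbd2006, Ex 5.6, p. 68] -/
theorem ex56CompactRigidityStatement_of_certifies_one
    (hone : ∀ (D D' : TemperedArithmeticGroup K) (T : StableReductionTower 𝓥 D) (T' : StableReductionTower 𝓥 D'),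
      Ω.IsStableReductionTowerOf D T → Ω.IsStableReductionTowerOf D' T' → D = D' ∧ HEq T T') :
    Ex56CompactRigidityStatement Ω := by
  intro D D' _ _ T T' hT hT' α _ _
  obtain ⟨rfl, hTT'⟩ := hone D D' T T' hT hT'
  obtain rfl := eq_of_heq hTT'
  exact T.exists_compatibleIsos_self

end Diagonal

end Literature.AnabelianGeometry.SemiGraphs
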